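import Summits.BirchSwinnertonDyer.Rank1Residual.X4.Gamma1ModularSymbols
import HarnessLib

/-!
# Level lowering kills Kurihara numbers mod `p`, part 4d: the `Γ₀`-descent of the twist of a form WITH NEBENTYPUS by a character of ANY ORDER and its modular symbols — the analytic input `hsym` of the principal-series template over `ℂ` (cell `b2b-bsdres`, seat additive-p4, line V80)

HONEST FRAMING (verbatim, cell `b2b-bsdres`): the goal of the cell is to DELETE the COMBINATION-SHAPED
residual classes for ALL analytic-rank `≤ 1` curves over `ℚ` — "full BSD formula for every rank `≤ 1`
curve in class `C`" assembled STRICTLY from published theorems — so that the rank-`≤ 1` remainder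
becomes exactly the CONSTRUCTION-SHAPED classes, which are TYPED (missing-input Props), NOT attempted;
this is not "finishing BSD". This file: research-route KERNEL THEOREMS (complex analysis over the
tree's `twistRaw1` / `modularSymbol` and part 4c's `modularSymbol1`; no named fact, no conjecture,
nothing booked; class X4 stays CONSTRUCTION-SHAPED).

## What is proved

THE `Γ₀`-DESCENT when the target character is trivial (`ψ χ² = 1` as characters mod `L` — the case
`f_W = g ⊗ χ̄` of an elliptic curve `W` with a principal-series additive prime: source newform `g` with
nebentypus, `χ` of order `e > 2`):

* `apply_mul_apply_sq_eq_one_of_mem_Gamma0`: `ψ(d)χ(d)² = 1` on `Γ₀(L)`; **`charTwist1`**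
  `= g(χ⁻¹)⁻¹ • twistRaw1 f χ` as an honest element of `S_k(Γ₀(L))` (Shimura 1971, Prop. 3.64,
  "`f_χ ∈ S_k(Γ₀(M), ψχ²)`", trivial target character; the tree's `charTwist` is the case `ψ = 1`,
  `χ² = 1`); its `q`-expansion **`cuspCoeff_charTwist1`**: `aₙ(charTwist1 f χ) = χ(n) aₙ(f)` for
  primitive `χ` (so for a newform `g` with `a_n(f_W) = χ(n) a_n(g)` this IS `f_W`, by the `Γ₀`
  `q`-expansion principle in the tree);
* **`modularSymbol_charTwist1`** — THE TREE'S `Γ₀` MODULAR SYMBOL of the descended twist: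
  `modularSymbol (charTwist1 f χ) r = g(χ⁻¹)⁻¹ ∑_{u mod m} χ⁻¹(u) · modularSymbol1 f (r + u/m)` for every
  `r ∈ ℚ` (part 4c's `Γ₁` symbols on the right);
* for EVEN `χ` (every character of odd order, e.g. the cubic `χ` of the cell's principal-series row)
  **`plusSymbol_charTwist1_of_even`** / `minusSymbol_charTwist1_of_even`:
  `plusSymbol (charTwist1 f χ) r = g(χ⁻¹)⁻¹ ∑_u χ⁻¹(u) · plusSymbol1 f (r + u/m)` — exactly the shape
  `[r]⁺_{f_W} = c₀ · ∑_u χ'(u) σ(r + u/m)` of part 4b's hypothesis `hsym`, over `ℂ`, with `χ' = χ⁻¹`,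
  `c₀ = g(χ⁻¹)⁻¹` and `σ` = the `Γ₁` plus symbol of the source.

What this does NOT give (typed, not attempted): part 4b's `hsym` is a statement in `ℤ/p`; between
this file's complex identity and it lie (i) ALGEBRAICITY of the `Γ₁` symbols `{∞, r}^±_g / Ω^±_g` in
the coefficient field `K_g` (Manin–Drinfeld / Shimura 1977 for newforms with character — the tree's
`PeriodRationality` / `ratPlusSymbol` are `Γ₀`- and `ℚ`-typed), (ii) the PERIOD COMPARISON
`Ω⁺_{f_W} / (g(χ̄)⁻¹ Ω⁺_g)` a `𝔭`-adic unit, and (iii) reduction mod a prime `𝔭 ∣ p` of `K_g(χ)` split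
by `e ∣ p − 1`. None is asserted here.

## References

* G. Shimura, *Introduction to the arithmetic theory of automorphic functions* (1971), Prop. 3.64.
  [cite: Shimura1971, Prop. 3.64]
* B. Mazur, J. Tate, J. Teitelbaum, Invent. Math. 84 (1986), §I.8 (twisted modular symbols).
  [cite: MazurTateTeitelbaum1986Invent, §I.8]
* Ju. I. Manin, *Parabolic points and zeta functions of modular curves*, Izv. 6 (1972), §1.2–§1.5.
  [cite: Manin1972, §1.2–1.5]
-/

noncomputable section

open scoped MatrixGroups ModularForm Real

open CongruenceSubgroup Matrix.SpecialLinearGroup Matrix.GeneralLinearGroup UpperHalfPlane Complex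
  MeasureTheory Set

open Literature.NumberTheory.EllipticCurves Literature.NumberTheory.EllipticCurves.ModularForms

namespace Summit.BirchSwinnertonDyer.Rank1Residual.NebentypusTwist

/-! ### §3 The `Γ₀(L)`-descent when the target character is trivial, and the tree's `Γ₀` symbol of it -/

section Descent

variable {N : ℕ} [NeZero N] {k : ℤ} {m : ℕ} [NeZero m] (L : ℕ) [NeZero L]

omit [NeZero N] [NeZero m] [NeZero L] in
/-- **`ψ(d) χ(d)² = 1` on `Γ₀(L)` when `ψ χ²` is the trivial character mod `L`** (`N ∣ L`, `m ∣ L`;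
`d` is a unit mod `L`, and the level-changed characters evaluate at `d` as `ψ(d mod N)`, `χ(d mod m)`).
[folklore] -/
theorem apply_mul_apply_sq_eq_one_of_mem_Gamma0 (hN : N ∣ L) (hmL : m ∣ L)
    {ψ : DirichletCharacter ℂ N} {χ : DirichletCharacter ℂ m}
    (hψχ : DirichletCharacter.changeLevel hN ψ * DirichletCharacter.changeLevel hmL χ ^ 2 = 1)
    {γ : SL(2, ℤ)} (hγ : γ ∈ Gamma0 L) :
    ψ (((γ 1 1 : ℤ) : ZMod N)) * χ (((γ 1 1 : ℤ) : ZMod m)) ^ 2 = 1 := by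
  have hcop : IsCoprime ((γ 1 1 : ℤ)) (L : ℤ) := by
    have hdet := Matrix.SpecialLinearGroup.det_coe γ
    rw [Matrix.det_fin_two] at hdet
    obtain ⟨c₀, hc₀⟩ := dvd_entry_of_mem_Gamma0 L hγ
    refine ⟨(γ 0 0 : ℤ), -((γ 0 1 : ℤ)) * c₀, ?_⟩
    linear_combination hdet + ((γ 0 1 : ℤ)) * hc₀
  have hunit : IsUnit (((γ 1 1 : ℤ) : ZMod L)) :=
    isUnit_intCast_entry_of_dvd γ (dvd_entry_of_mem_Gamma0 L hγ)
  have h := congrArg (fun θ : DirichletCharacter ℂ L ↦ θ (((γ 1 1 : ℤ)) : ZMod L)) hψχ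
  simp only [MulChar.mul_apply, MulChar.pow_apply' _ two_ne_zero, MulChar.one_apply hunit] at h
  rwa [DirichletCharacter.changeLevel_eq_cast_of_dvd' ψ hN hcop,
    DirichletCharacter.changeLevel_eq_cast_of_dvd' χ hmL hcop] at h

/-- **The twist `g(χ⁻¹)⁻¹ ∑_{u mod m} χ⁻¹(u) f(τ + u/m)` of a form `f ∈ S_k(N, ψ)` WITH NEBENTYPUS by a
Dirichlet character `χ mod m` of ANY ORDER with `ψ χ² = 1` (as characters mod `L`), as an honest cusp
form on `Γ₀(L)`** (`N ∣ L`, `m² ∣ L`, `N m ∣ L`, `m ∣ L`): Shimura 1971, Prop. 3.64 —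
"`f_χ ∈ S_k(Γ₀(M), ψχ²)`" — in the case where the target character is TRIVIAL, which is the case
`f_W = g ⊗ χ̄` of an elliptic curve `W` with a principal-series prime (`ρ_W|_{I_p} = χ₁ ⊕ χ₁⁻¹`, source
newform `g` with nebentypus `χ̄₁²`-shaped). The underlying function is
`g(χ⁻¹)⁻¹ • twistRaw1 f χ`; it is `Γ₀(L)`-invariant by the tree's `coe_twistRaw1_slash`
(multiplier `ψ(d)χ(d)² = 1`, `apply_mul_apply_sq_eq_one_of_mem_Gamma0`). The tree's `charTwist` is the
case `ψ = 1`, `χ² = 1`. Junk value `0` if `g(χ⁻¹) = 0` (impossible for primitive `χ`).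
[cite: Shimura1971, Prop. 3.64] -/
def charTwist1 (hN : N ∣ L) (hm : m ^ 2 ∣ L) (hNm : N * m ∣ L) (hmL : m ∣ L)
    {ψ : DirichletCharacter ℂ N} {f : CuspForm (Gamma1 N) k} (hf : f ∈ nebentypusSubspace N k ψ)
    {χ : DirichletCharacter ℂ m}
    (hψχ : DirichletCharacter.changeLevel hN ψ * DirichletCharacter.changeLevel hmL χ ^ 2 = 1) :
    CuspForm (Gamma0 L) k :=
  cuspFormOfInvariant ((gaussSum χ⁻¹ (ZMod.stdAddChar (N := m)))⁻¹ • twistRaw1 L hN hm hNm hf χ)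
    fun g hg ↦ by
      obtain ⟨γ, hγ, rfl⟩ := hg
      rw [CuspForm.IsGLPos.coe_smul, ModularForm.smul_slash, σ_mapGL,
        coe_twistRaw1_slash L hN hm hNm hf χ hγ, apply_mul_apply_sq_eq_one_of_mem_Gamma0 L hN hmL hψχ hγ,
        one_smul]

/-- The underlying function of `charTwist1`: `g(χ⁻¹)⁻¹ • twistRaw1 f χ`. [folklore] -/
theorem coe_charTwist1 (hN : N ∣ L) (hm : m ^ 2 ∣ L) (hNm : N * m ∣ L) (hmL : m ∣ L)
    {ψ : DirichletCharacter ℂ N} {f : CuspForm (Gamma1 N) k} (hf : f ∈ nebentypusSubspace N k ψ)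
    {χ : DirichletCharacter ℂ m}
    (hψχ : DirichletCharacter.changeLevel hN ψ * DirichletCharacter.changeLevel hmL χ ^ 2 = 1) :
    (⇑(charTwist1 L hN hm hNm hmL hf hψχ) : ℍ → ℂ) =
      (gaussSum χ⁻¹ (ZMod.stdAddChar (N := m)))⁻¹ • (⇑(twistRaw1 L hN hm hNm hf χ) : ℍ → ℂ) :=
  rfl

/-- **`q`-expansion of the descended twist**: `aₙ(charTwist1 f χ) = χ(n) aₙ(f)` for primitive `χ`
(Shimura 1971, Prop. 3.64: "`f_χ(z) = ∑ χ(n) aₙ e(nz)`"; the tree's `cuspCoeff_twistRaw1` divided by the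
non-zero Gauss sum `g(χ⁻¹)`). [cite: Shimura1971, Prop. 3.64] -/
theorem cuspCoeff_charTwist1 (hN : N ∣ L) (hm : m ^ 2 ∣ L) (hNm : N * m ∣ L) (hmL : m ∣ L)
    {ψ : DirichletCharacter ℂ N} {f : CuspForm (Gamma1 N) k} (hf : f ∈ nebentypusSubspace N k ψ)
    {χ : DirichletCharacter ℂ m}
    (hψχ : DirichletCharacter.changeLevel hN ψ * DirichletCharacter.changeLevel hmL χ ^ 2 = 1)
    (hprim : χ.IsPrimitive) (n : ℕ) :
    cuspCoeff (charTwist1 L hN hm hNm hmL hf hψχ) n = χ n * cuspCoeff f n := by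
  have hg : gaussSum χ⁻¹ (ZMod.stdAddChar (N := m)) ≠ 0 :=
    gaussSum_stdAddChar_ne_zero_of_isPrimitive (isPrimitive_inv hprim)
  have hΓ' : (1 : ℝ) ∈ ((Gamma0 L : Subgroup SL(2, ℤ)) : Subgroup (GL (Fin 2) ℝ)).strictPeriods :=
    strictWidthInfty_Gamma0 L ▸ Subgroup.strictWidthInfty_mem_strictPeriods _
  have hsum : ∀ τ : ℍ, HasSum (fun n : ℕ ↦ (χ n * cuspCoeff f n) •
      Function.Periodic.qParam 1 (τ : ℂ) ^ n) (charTwist1 L hN hm hNm hmL hf hψχ τ) := by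
    intro τ
    have h := (hasSum_twistRaw1 L hN hm hNm hf χ τ).mul_left
      (gaussSum χ⁻¹ (ZMod.stdAddChar (N := m)))⁻¹
    rw [show (gaussSum χ⁻¹ (ZMod.stdAddChar (N := m)))⁻¹ * twistRaw1 L hN hm hNm hf χ τ =
      charTwist1 L hN hm hNm hmL hf hψχ τ from rfl] at h
    simp_rw [sum_inv_mul_stdAddChar_eq hprim] at h
    refine h.congr_fun fun n ↦ ?_
    simp only [smul_eq_mul]
    field_simp
  rw [cuspCoeff, ← ModularFormClass.qExpansion_coeff_unique one_pos hΓ' hsum n]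

/-- **The descended twist along the vertical ray above a cusp** (weight `2`): for `t > 0`,
`(charTwist1 f χ)(r + it) = g(χ⁻¹)⁻¹ ∑_{u mod m} χ⁻¹(u) f((r + u/m) + it)`.
[cite: Shimura1971, Prop. 3.64] -/
theorem charTwist1_apply_ofComplex (hN : N ∣ L) (hm : m ^ 2 ∣ L) (hNm : N * m ∣ L) (hmL : m ∣ L)
    {ψ : DirichletCharacter ℂ N} {f : CuspForm (Gamma1 N) 2} (hf : f ∈ nebentypusSubspace N 2 ψ)
    {χ : DirichletCharacter ℂ m}
    (hψχ : DirichletCharacter.changeLevel hN ψ * DirichletCharacter.changeLevel hmL χ ^ 2 = 1)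
    (r : ℚ) {t : ℝ} (ht : 0 < t) :
    charTwist1 L hN hm hNm hmL hf hψχ (ofComplex ((r : ℂ) + t * Complex.I)) =
      (gaussSum χ⁻¹ (ZMod.stdAddChar (N := m)))⁻¹ *
        ∑ u : ZMod m, χ⁻¹ u * f (ofComplex (((r + twistShift u : ℚ) : ℂ) + t * Complex.I)) := by
  have hcoe := congrFun (coe_charTwist1 L hN hm hNm hmL hf hψχ) (ofComplex ((r : ℂ) + t * Complex.I))
  rw [hcoe, Pi.smul_apply, smul_eq_mul, twistRaw1_apply_ofComplex L hN hm hNm hf χ r ht]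

/-- **THE TREE'S `Γ₀` MODULAR SYMBOL OF THE DESCENDED TWIST** (Shimura 1971, Prop. 3.64 at the level
of modular symbols, source with nebentypus, character of any order): for `f ∈ S₂(N, ψ)`, `χ mod m` with
`ψ χ² = 1` mod `L`, and every `r ∈ ℚ`,
`modularSymbol (charTwist1 f χ) r = g(χ⁻¹)⁻¹ ∑_{u mod m} χ⁻¹(u) · modularSymbol1 f (r + u/m)` —
the left side is the tree's `ModularForms.modularSymbol` of an honest `Γ₀(L)`-form, the right side the
`Γ₁` symbols of §1. This is the complex-analytic content of part 4b's hypothesis `hsym` for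
`f_W = g ⊗ χ`. [cite: Shimura1971, Prop. 3.64] [cite: MazurTateTeitelbaum1986Invent, §I.8] -/
theorem modularSymbol_charTwist1 (hN : N ∣ L) (hm : m ^ 2 ∣ L) (hNm : N * m ∣ L) (hmL : m ∣ L)
    {ψ : DirichletCharacter ℂ N} {f : CuspForm (Gamma1 N) 2} (hf : f ∈ nebentypusSubspace N 2 ψ)
    {χ : DirichletCharacter ℂ m}
    (hψχ : DirichletCharacter.changeLevel hN ψ * DirichletCharacter.changeLevel hmL χ ^ 2 = 1)
    (r : ℚ) :
    modularSymbol (charTwist1 L hN hm hNm hmL hf hψχ) r =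
      (gaussSum χ⁻¹ (ZMod.stdAddChar (N := m)))⁻¹ *
        ∑ u : ZMod m, χ⁻¹ u * modularSymbol1 f (r + twistShift u) := by
  have hint : ∀ u : ZMod m, IntegrableOn
      (fun t : ℝ ↦ χ⁻¹ u * f (ofComplex (((r + twistShift u : ℚ) : ℂ) + t * Complex.I)))
      (Ioi 0) := fun u ↦
    (integrableOn_modularSymbol1_integrand f (r + twistShift u)).const_mul (χ⁻¹ u)
  have key : ∫ t in Ioi (0 : ℝ),
      charTwist1 L hN hm hNm hmL hf hψχ (ofComplex ((r : ℂ) + t * Complex.I)) =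
      (gaussSum χ⁻¹ (ZMod.stdAddChar (N := m)))⁻¹ *
        ∑ u : ZMod m, χ⁻¹ u * ∫ t in Ioi (0 : ℝ),
          f (ofComplex (((r + twistShift u : ℚ) : ℂ) + t * Complex.I)) := by
    rw [setIntegral_congr_fun measurableSet_Ioi
      (fun t ht ↦ charTwist1_apply_ofComplex L hN hm hNm hmL hf hψχ r ht), integral_const_mul,
      integral_finsetSum _ (fun u _ ↦ hint u)]
    congr 1
    refine Finset.sum_congr rfl fun u _ ↦ ?_
    exact integral_const_mul _ _
  simp only [modularSymbol, modularSymbol1]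
  rw [key, Finset.mul_sum, Finset.mul_sum, Finset.mul_sum]
  exact Finset.sum_congr rfl fun u _ ↦ by ring

/-- **PLUS SYMBOL OF THE DESCENDED TWIST, EVEN `χ`** (e.g. `χ` cubic — every character of odd order is
even): `plusSymbol (charTwist1 f χ) r = g(χ⁻¹)⁻¹ ∑_{u mod m} χ⁻¹(u) · plusSymbol1 f (r + u/m)` — the
shape `[r]⁺_{f_W} = c₀ · ∑_u χ'(u) σ(r + u/m)` of part 4b's `hsym` over `ℂ`, with `χ' = χ⁻¹`,
`c₀ = g(χ⁻¹)⁻¹`, `σ = plusSymbol1 f`. [cite: Shimura1971, Prop. 3.64] [cite: MazurTateTeitelbaum1986Invent, §I.8] -/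
theorem plusSymbol_charTwist1_of_even (hN : N ∣ L) (hm : m ^ 2 ∣ L) (hNm : N * m ∣ L) (hmL : m ∣ L)
    {ψ : DirichletCharacter ℂ N} {f : CuspForm (Gamma1 N) 2} (hf : f ∈ nebentypusSubspace N 2 ψ)
    {χ : DirichletCharacter ℂ m}
    (hψχ : DirichletCharacter.changeLevel hN ψ * DirichletCharacter.changeLevel hmL χ ^ 2 = 1)
    (hχe : χ.Even) (r : ℚ) :
    plusSymbol (charTwist1 L hN hm hNm hmL hf hψχ) r =
      (gaussSum χ⁻¹ (ZMod.stdAddChar (N := m)))⁻¹ *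
        ∑ u : ZMod m, χ⁻¹ u * plusSymbol1 f (r + twistShift u) := by
  simp only [plusSymbol, plusSymbol1]
  rw [modularSymbol_charTwist1, modularSymbol_charTwist1,
    sum_mul_modularSymbol1_neg_add_of_even f (even_inv_of_even hχe), ← mul_add,
    ← Finset.sum_add_distrib, mul_div_assoc, Finset.sum_div]
  congr 1
  exact Finset.sum_congr rfl fun u _ ↦ by ring

/-- **MINUS SYMBOL OF THE DESCENDED TWIST, EVEN `χ`**:
`minusSymbol (charTwist1 f χ) r = g(χ⁻¹)⁻¹ ∑_{u mod m} χ⁻¹(u) · minusSymbol1 f (r + u/m)`.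
[cite: Shimura1971, Prop. 3.64] [cite: MazurTateTeitelbaum1986Invent, §I.8] -/
theorem minusSymbol_charTwist1_of_even (hN : N ∣ L) (hm : m ^ 2 ∣ L) (hNm : N * m ∣ L) (hmL : m ∣ L)
    {ψ : DirichletCharacter ℂ N} {f : CuspForm (Gamma1 N) 2} (hf : f ∈ nebentypusSubspace N 2 ψ)
    {χ : DirichletCharacter ℂ m}
    (hψχ : DirichletCharacter.changeLevel hN ψ * DirichletCharacter.changeLevel hmL χ ^ 2 = 1)
    (hχe : χ.Even) (r : ℚ) :
    minusSymbol (charTwist1 L hN hm hNm hmL hf hψχ) r =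
      (gaussSum χ⁻¹ (ZMod.stdAddChar (N := m)))⁻¹ *
        ∑ u : ZMod m, χ⁻¹ u * minusSymbol1 f (r + twistShift u) := by
  simp only [minusSymbol, minusSymbol1]
  rw [modularSymbol_charTwist1, modularSymbol_charTwist1,
    sum_mul_modularSymbol1_neg_add_of_even f (even_inv_of_even hχe), ← mul_sub,
    ← Finset.sum_sub_distrib, mul_div_assoc, Finset.sum_div]
  congr 1
  exact Finset.sum_congr rfl fun u _ ↦ by ring

end Descent

end Summit.BirchSwinnertonDyer.Rank1Residual.NebentypusTwist

end
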